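import Summits.QuantumFields.YangMills.Theorems.BalabanUVNodesN15KingModelFreeRGBlockSpinGauss
import HarnessLib

/-!
# BalabanUVNodes ∕ N15 — THE KING-MODEL RUNG, FREE-FIELD EDITION (PART Τ-j₁): THE SEMIGROUP LAW OF THE BLOCK-SPIN TRANSFORMATION ON **ALL
# DENSITIES** — Chapman–Kolmogorov for Gaussian block kernels with `QQᵀ = c·1`:
# `√(α∕2π)^{|κ|}√(β∕2π)^{|ι|}∫dφ′ e^{−½α‖ψ−Qφ′‖²}e^{−½β‖φ′−v‖²} = √(γ∕2π)^{|κ|}e^{−½γ‖ψ−Qv‖²}`, `γ⁻¹ = α⁻¹ + c·β⁻¹`, and hence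
# `T_α^{Q} ∘ T_β^{Q′} = T_γ^{QQ′}` for the operators `(T_α^{Q}F)(ψ) = √(α∕2π)^{|κ|}∫dφ e^{−½α‖ψ−Qφ‖²}F(φ)` acting on EVERY integrable `F`
# ([King1986] (2.15) `T_{a,L}^k = T_{a_k,L^k}`, the kernel algebra behind it; Track A, DAG node N15 = NE2; FAN-OUT v1.1 §N15 s3 «KING-MODEL RUNG»;
# regen R453 (b))

HONEST FRAMING.  Count-neutral (cell `pub-ymgap`, seat `pub-ymgap-dag-n15-e` g20; `--supports stmt-QuantumFields-27366 --as helper` = K3⁸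
`SpineGivenEndpointR13SepCoPHV`).  PURE finite-dimensional Gaussian calculus on `κ → ℝ`, `ι → ℝ`, `ι′ → ℝ` with Lebesgue measure (Mathlib); no King
object, no Bałaban object, no record key.  WHY: [King1986] p. 653 uses the block-spin transformation of [Ba 1] and its COMPOSITION LAW
`T_{a,L}^k = T_{a_k,L^k}`, `a_k = a(1−L⁻²)(1−L^{−2k})⁻¹` ((2.13)–(2.15)), for the FULL (interacting) measure: the `k`-fold iterate of the one-step
transformation is again ONE Gaussian block-spin transformation with block `L^k` and constant `a_k`.  Part Τ-i₃ (`…FreeRGBlockSpinStep`, this seat) proved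
(2.15) only as the agreement of two integral representations of the FREE-FIELD densities (its HONEST SCOPE (iv)).  THIS FILE proves the law AS AN
OPERATOR IDENTITY ON ALL INTEGRABLE DENSITIES, in the generic form its proof needs: for block maps `Q : Matrix κ ι ℝ` with `QQᵀ = c·1` (King's rescaled
means `Q̃_k = (L^k)^{(d−2)∕2}Q_{L^k}` have `Q̃_kQ̃_kᵀ = L^{−2k}·1`, part Τ-j₂) the Gaussian transition kernels compose à la Chapman–Kolmogorov with
`γ⁻¹ = α⁻¹ + cβ⁻¹` — which at `α = a_k`, `β = a_n`, `c = L^{−2k}` IS the tree's `King1986.inv_aK_add` `a_{k+n}⁻¹ = a_k⁻¹ + L^{−2k}a_n⁻¹`; part Τ-j₂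
(`…FreeRGSemigroupKing`) instantiates it BY NAME on King's tori.
WHAT IS HERE (generic):
* §1 PUSH-THROUGH: `QQᵀ = c·1` ⇒ `(β·1 + αQᵀQ)⁻¹Qᵀ = (β + αc)⁻¹Qᵀ` and `bsEff α Q (β·1) = γ·1`, `γ = αβ∕(β + αc)` (part Τ-i₁'s effective operator
  of a step applied to an ISOTROPIC Gaussian is isotropic);
* §2 ★ CHAPMAN–KOLMOGOROV `integral_kernel_kernel` ∕ `chapmanKolmogorov_blockSpin`: the `φ′`-integral of the product of the two transition densities
  `N_α e^{−½α‖ψ−Qφ′‖²}` and `N_β e^{−½β‖φ′−v‖²}` is the transition density `N_γ e^{−½γ‖ψ−Qv‖²}` (translation invariance + part Τ-i₁ `integral_exp_blockSpin`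
  at `T = β·1`; the constant from part Τ-i₁'s MASS PRESERVATION `gaussNorm_bsEff_mul` — determinant-free);
* §3 ★★ `blockSpinOp_comp` — THE SEMIGROUP LAW ON DENSITIES: for every integrable `F : (ι′ → ℝ) → ℝ` and every block map `Q′ : Matrix ι ι′ ℝ`,
  `√(α∕2π)^{|κ|}∫dφ′ e^{−½α‖ψ−Qφ′‖²}·[√(β∕2π)^{|ι|}∫dφ e^{−½β‖φ′−Q′φ‖²}F(φ)] = √(γ∕2π)^{|κ|}∫dφ e^{−½γ‖ψ−Q(Q′φ)‖²}F(φ)` (Fubini for the density: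
  `integrable_prod_iff'` — fibres are Gaussian, fibre masses `≤ 𝒩·|F|`).
HONEST SCOPE: the weights are King's block-spin Gaussians at `A = 0` for a one-component scalar (`‖·‖²` the plain sum of squares); Bałaban's covariant
averages `Q(A)` and the vector-field transformation are not touched; `F` is any Lebesgue-integrable function (the interacting densities `e^{−S}χ…` of
[Ba 1–4] are such, but none is constructed here).  NOT Bałaban's objects; NOT a node discharge; nothing continuum-YM ∕ ℝ⁴ ∕ OS ∕ mass-gap ∕ Clay.
0 `sorry`; NO definition; standard axioms.  READING NOTE (ref-K READ-340, carried): every `𝒩(·)` below is a genuine positive integral under the stated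
positivity letters (`0 < α`, `0 < β`, `0 ≤ c`).  DEDUP: the one-kernel step and mass preservation are part Τ-i₁'s (imported); the conditional step over
sub-domains is lit-balaban p15's `B2Eq234SecondRepr`; new here = the composition of two block kernels and the operator law on densities.
Locators: [King1986] (2.4)–(2.6) p.652, (2.13)–(2.15) p.653; [Balaban1982Higgs1] §2 pp.608–612 (the transformation `T_{a,L}` King cites as [Ba 1]).
-/

noncomputable section

namespace Summit.QuantumFields.YangMills.BalabanUVNodes.N15KingModelRung.FreeField

open Real Finset Matrix MeasureTheory
open Literature.MathematicalPhysics.QuantumFieldTheory.Balaban1983to89.QGQInverse (Coercive isUnit_of_coercive)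
open Literature.LinearAlgebra.Matrix (dotProduct_self_nonneg_real)

variable {κ ι ι' : Type*} [Fintype κ] [Fintype ι] [Fintype ι'] [DecidableEq κ] [DecidableEq ι]

/-! ## §1 Push-through: the step applied to an isotropic Gaussian is isotropic when `QQᵀ = c·1` -/

section PushThrough

variable {α β c : ℝ} {Q : Matrix κ ι ℝ}

/-- `(β·1 + αQᵀQ)Qᵀ = (β + αc)Qᵀ` when `QQᵀ = c·1`. [folklore] -/
theorem bsPrec_scalar_mul_transpose (hQ : Q * Qᵀ = c • (1 : Matrix κ κ ℝ)) :
    bsPrec α Q (β • (1 : Matrix ι ι ℝ)) * Qᵀ = (β + α * c) • Qᵀ := by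
  rw [bsPrec, Matrix.add_mul, Matrix.smul_mul, Matrix.one_mul, Matrix.smul_mul, Matrix.mul_assoc, hQ, Matrix.mul_smul,
    Matrix.mul_one, smul_smul, ← add_smul]

/-- **Push-through**: `(β·1 + αQᵀQ)⁻¹Qᵀ = (β + αc)⁻¹Qᵀ` (`β > 0`, `α, c ≥ 0`). [folklore] -/
theorem inv_bsPrec_scalar_mul_transpose (hβ : 0 < β) (hα : 0 ≤ α) (hc : 0 ≤ c) (hQ : Q * Qᵀ = c • (1 : Matrix κ κ ℝ)) :
    (bsPrec α Q (β • (1 : Matrix ι ι ℝ)))⁻¹ * Qᵀ = (β + α * c)⁻¹ • Qᵀ := by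
  have hB : IsUnit (bsPrec α Q (β • (1 : Matrix ι ι ℝ))) :=
    isUnit_of_coercive hβ (coercive_bsPrec Q _ hα (coercive_scalar β))
  have hdet : IsUnit (bsPrec α Q (β • (1 : Matrix ι ι ℝ))).det := (Matrix.isUnit_iff_isUnit_det _).mp hB
  have hne : β + α * c ≠ 0 := by positivity
  calc (bsPrec α Q (β • (1 : Matrix ι ι ℝ)))⁻¹ * Qᵀ
      = (β + α * c)⁻¹ • ((bsPrec α Q (β • (1 : Matrix ι ι ℝ)))⁻¹ * ((β + α * c) • Qᵀ)) := by
        rw [Matrix.mul_smul, smul_smul, inv_mul_cancel₀ hne, one_smul]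
    _ = (β + α * c)⁻¹ • Qᵀ := by
        rw [← bsPrec_scalar_mul_transpose hQ, ← Matrix.mul_assoc, Matrix.nonsing_inv_mul _ hdet, Matrix.one_mul]

/-- **The effective operator of a step on an isotropic Gaussian is isotropic**: `bsEff α Q (β·1) = γ·1`, `γ = αβ∕(β + αc)` — i.e.
`γ⁻¹ = α⁻¹ + c·β⁻¹` (the composition law of the Gaussian constants; King's `a_{k+n}⁻¹ = a_k⁻¹ + L^{−2k}a_n⁻¹`). [cite: King1986, (2.13)–(2.15) p.653] -/
theorem bsEff_scalar_of_mul_transpose (hβ : 0 < β) (hα : 0 ≤ α) (hc : 0 ≤ c) (hQ : Q * Qᵀ = c • (1 : Matrix κ κ ℝ)) :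
    bsEff α Q (β • (1 : Matrix ι ι ℝ)) = (α * β / (β + α * c)) • (1 : Matrix κ κ ℝ) := by
  have hne : β + α * c ≠ 0 := by positivity
  rw [bsEff, Matrix.mul_assoc, inv_bsPrec_scalar_mul_transpose hβ hα hc hQ, Matrix.mul_smul, hQ, smul_smul, smul_smul, ← sub_smul]
  congr 1
  field_simp
  ring

/-- The composed constant is positive. [folklore] -/
theorem comp_const_pos (hα : 0 < α) (hβ : 0 < β) (hc : 0 ≤ c) : 0 < α * β / (β + α * c) := by positivity

end PushThrough

/-! ## §2 ★ Chapman–Kolmogorov for two Gaussian block kernels -/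

section ChapmanKolmogorov

variable {α β c : ℝ} (Q : Matrix κ ι ℝ)

omit [DecidableEq κ] in
/-- The shifted two-kernel integrand is part Τ-i₁'s one-step integrand at `T = β·1` and coarse field `ψ − Qv`. [folklore] -/
theorem kernel_kernel_shift (ψ : κ → ℝ) (v η : ι → ℝ) :
    Real.exp (-(1 / 2 : ℝ) * (α * ((ψ - Q *ᵥ (v + η)) ⬝ᵥ (ψ - Q *ᵥ (v + η)))))
        * Real.exp (-(1 / 2 : ℝ) * (β * (((v + η) - v) ⬝ᵥ ((v + η) - v))))
      = Real.exp (-(1 / 2 : ℝ) * (α * (((ψ - Q *ᵥ v) - Q *ᵥ η) ⬝ᵥ ((ψ - Q *ᵥ v) - Q *ᵥ η))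
          + η ⬝ᵥ ((β • (1 : Matrix ι ι ℝ)) *ᵥ η))) := by
  rw [← Real.exp_add, Matrix.mulVec_add, sub_add_eq_sub_sub, add_sub_cancel_left, quad_scalar_dot]
  congr 1
  ring

/-- ★ **CHAPMAN–KOLMOGOROV, unnormalised**: for `QQᵀ = c·1`, `α, β > 0`,
`∫dφ′ e^{−½α‖ψ−Qφ′‖²}·e^{−½β‖φ′−v‖²} = 𝒩(β·1 + αQᵀQ)·e^{−½γ‖ψ − Qv‖²}`, `γ = αβ∕(β+αc)` (translate `φ′ = v + η`, part Τ-i₁ `integral_exp_blockSpin`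
at `T = β·1`, and §1). [cite: King1986, (2.13)–(2.15) p.653] -/
theorem integral_kernel_kernel (hα : 0 < α) (hβ : 0 < β) (hc : 0 ≤ c) (hQ : Q * Qᵀ = c • (1 : Matrix κ κ ℝ)) (ψ : κ → ℝ) (v : ι → ℝ) :
    ∫ φ' : ι → ℝ, Real.exp (-(1 / 2 : ℝ) * (α * ((ψ - Q *ᵥ φ') ⬝ᵥ (ψ - Q *ᵥ φ'))))
          * Real.exp (-(1 / 2 : ℝ) * (β * ((φ' - v) ⬝ᵥ (φ' - v))))
      = gaussNorm (bsPrec α Q (β • (1 : Matrix ι ι ℝ)))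
          * Real.exp (-(1 / 2 : ℝ) * ((α * β / (β + α * c)) * ((ψ - Q *ᵥ v) ⬝ᵥ (ψ - Q *ᵥ v)))) := by
  have hsymm : (β • (1 : Matrix ι ι ℝ))ᵀ = β • (1 : Matrix ι ι ℝ) := by rw [Matrix.transpose_smul, Matrix.transpose_one]
  have h := integral_add_left_eq_self (μ := (volume : Measure (ι → ℝ)))
    (fun φ' : ι → ℝ => Real.exp (-(1 / 2 : ℝ) * (α * ((ψ - Q *ᵥ φ') ⬝ᵥ (ψ - Q *ᵥ φ'))))
      * Real.exp (-(1 / 2 : ℝ) * (β * ((φ' - v) ⬝ᵥ (φ' - v))))) v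
  rw [← h]
  have h2 : (∫ η : ι → ℝ, (fun φ' : ι → ℝ => Real.exp (-(1 / 2 : ℝ) * (α * ((ψ - Q *ᵥ φ') ⬝ᵥ (ψ - Q *ᵥ φ'))))
        * Real.exp (-(1 / 2 : ℝ) * (β * ((φ' - v) ⬝ᵥ (φ' - v))))) (v + η))
      = ∫ η : ι → ℝ, Real.exp (-(1 / 2 : ℝ) * (α * (((ψ - Q *ᵥ v) - Q *ᵥ η) ⬝ᵥ ((ψ - Q *ᵥ v) - Q *ᵥ η))
          + η ⬝ᵥ ((β • (1 : Matrix ι ι ℝ)) *ᵥ η))) := by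
    refine integral_congr_ae (Filter.Eventually.of_forall fun η => ?_)
    beta_reduce
    exact kernel_kernel_shift Q ψ v η
  rw [h2, integral_exp_blockSpin Q hβ (coercive_scalar β) hsymm hα.le (ψ - Q *ᵥ v), bsEff_scalar_of_mul_transpose hβ hα.le hc hQ,
    quad_scalar_dot]

/-- The CONSTANT of the composed kernel: `√(α∕2π)^{|κ|}·√(β∕2π)^{|ι|}·𝒩(β·1 + αQᵀQ) = √(γ∕2π)^{|κ|}` (part Τ-i₁'s mass preservation at `T = β·1`
with §1, and `𝒩(b·1) = √(2π∕b)^n`). [cite: King1986, (2.6) p.652, (2.15) p.653] -/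
theorem gaussNorm_bsPrec_scalar (hα : 0 < α) (hβ : 0 < β) (hc : 0 ≤ c) (hQ : Q * Qᵀ = c • (1 : Matrix κ κ ℝ)) :
    Real.sqrt (α / (2 * π)) ^ Fintype.card κ * Real.sqrt (β / (2 * π)) ^ Fintype.card ι
        * gaussNorm (bsPrec α Q (β • (1 : Matrix ι ι ℝ)))
      = Real.sqrt ((α * β / (β + α * c)) / (2 * π)) ^ Fintype.card κ := by
  have hsymm : (β • (1 : Matrix ι ι ℝ))ᵀ = β • (1 : Matrix ι ι ℝ) := by rw [Matrix.transpose_smul, Matrix.transpose_one]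
  have hγ : 0 < α * β / (β + α * c) := comp_const_pos hα hβ hc
  have hmass := gaussNorm_bsEff_mul Q hβ (coercive_scalar β) hsymm hα
  rw [bsEff_scalar_of_mul_transpose hβ hα.le hc hQ, gaussNorm_scalar hγ, gaussNorm_scalar hβ] at hmass
  -- `hmass : √(2π/γ)^κ · 𝒩(bsPrec) = √(2π/α)^κ · √(2π/β)^ι`
  have hG : Real.sqrt (2 * π / (α * β / (β + α * c))) ^ Fintype.card κ ≠ 0 :=
    pow_ne_zero _ (Real.sqrt_pos.mpr (by positivity)).ne'
  have e1 : gaussNorm (bsPrec α Q (β • (1 : Matrix ι ι ℝ)))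
      = Real.sqrt (2 * π / α) ^ Fintype.card κ * Real.sqrt (2 * π / β) ^ Fintype.card ι
          / Real.sqrt (2 * π / (α * β / (β + α * c))) ^ Fintype.card κ := by
    rw [eq_div_iff hG, mul_comm]
    exact hmass
  rw [e1]
  have kα : Real.sqrt (α / (2 * π)) ^ Fintype.card κ * Real.sqrt (2 * π / α) ^ Fintype.card κ = 1 := by
    rw [← mul_pow, sqrt_div_mul_sqrt_div hα, one_pow]
  have kβ : Real.sqrt (β / (2 * π)) ^ Fintype.card ι * Real.sqrt (2 * π / β) ^ Fintype.card ι = 1 := by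
    rw [← mul_pow, sqrt_div_mul_sqrt_div hβ, one_pow]
  have kγ : Real.sqrt ((α * β / (β + α * c)) / (2 * π)) ^ Fintype.card κ
      * Real.sqrt (2 * π / (α * β / (β + α * c))) ^ Fintype.card κ = 1 := by
    rw [← mul_pow, sqrt_div_mul_sqrt_div hγ, one_pow]
  calc Real.sqrt (α / (2 * π)) ^ Fintype.card κ * Real.sqrt (β / (2 * π)) ^ Fintype.card ι
        * (Real.sqrt (2 * π / α) ^ Fintype.card κ * Real.sqrt (2 * π / β) ^ Fintype.card ι
            / Real.sqrt (2 * π / (α * β / (β + α * c))) ^ Fintype.card κ)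
      = (Real.sqrt (α / (2 * π)) ^ Fintype.card κ * Real.sqrt (2 * π / α) ^ Fintype.card κ)
          * (Real.sqrt (β / (2 * π)) ^ Fintype.card ι * Real.sqrt (2 * π / β) ^ Fintype.card ι)
          / Real.sqrt (2 * π / (α * β / (β + α * c))) ^ Fintype.card κ := by ring
    _ = 1 / Real.sqrt (2 * π / (α * β / (β + α * c))) ^ Fintype.card κ := by rw [kα, kβ, one_mul]
    _ = Real.sqrt ((α * β / (β + α * c)) / (2 * π)) ^ Fintype.card κ := by rw [div_eq_iff hG, kγ]

/-- ★ **CHAPMAN–KOLMOGOROV FOR KING'S KERNELS** (normalised): with `N_x = √(x∕2π)^{n}` the mass-one constants,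
`N_α N_β ∫dφ′ e^{−½α‖ψ−Qφ′‖²} e^{−½β‖φ′−v‖²} = N_γ e^{−½γ‖ψ−Qv‖²}`, `γ⁻¹ = α⁻¹ + cβ⁻¹` (`QQᵀ = c·1`): the transition density of «block-average then add
`β⁻¹`-noise, block-average then add `α⁻¹`-noise» is the transition density of ONE block-spin step. [cite: King1986, (2.13)–(2.15) p.653] -/
theorem chapmanKolmogorov_blockSpin (hα : 0 < α) (hβ : 0 < β) (hc : 0 ≤ c) (hQ : Q * Qᵀ = c • (1 : Matrix κ κ ℝ)) (ψ : κ → ℝ) (v : ι → ℝ) :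
    Real.sqrt (α / (2 * π)) ^ Fintype.card κ * Real.sqrt (β / (2 * π)) ^ Fintype.card ι
        * ∫ φ' : ι → ℝ, Real.exp (-(1 / 2 : ℝ) * (α * ((ψ - Q *ᵥ φ') ⬝ᵥ (ψ - Q *ᵥ φ'))))
            * Real.exp (-(1 / 2 : ℝ) * (β * ((φ' - v) ⬝ᵥ (φ' - v))))
      = Real.sqrt ((α * β / (β + α * c)) / (2 * π)) ^ Fintype.card κ
          * Real.exp (-(1 / 2 : ℝ) * ((α * β / (β + α * c)) * ((ψ - Q *ᵥ v) ⬝ᵥ (ψ - Q *ᵥ v)))) := by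
  rw [integral_kernel_kernel Q hα hβ hc hQ ψ v, ← mul_assoc, gaussNorm_bsPrec_scalar Q hα hβ hc hQ]

omit [DecidableEq κ] in
/-- The two-kernel integrand is integrable in `φ′`. [folklore] -/
theorem integrable_kernel_kernel (hα : 0 < α) (hβ : 0 < β) (ψ : κ → ℝ) (v : ι → ℝ) :
    Integrable fun φ' : ι → ℝ => Real.exp (-(1 / 2 : ℝ) * (α * ((ψ - Q *ᵥ φ') ⬝ᵥ (ψ - Q *ᵥ φ'))))
      * Real.exp (-(1 / 2 : ℝ) * (β * ((φ' - v) ⬝ᵥ (φ' - v)))) := by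
  have h0 := integrable_exp_blockSpin Q hβ (coercive_scalar β) hα.le (ψ - Q *ᵥ v) (T := β • (1 : Matrix ι ι ℝ))
  have h1 := h0.comp_add_left (-v)
  refine h1.congr (Filter.Eventually.of_forall fun φ' => ?_)
  beta_reduce
  rw [← kernel_kernel_shift Q ψ v (-v + φ')]
  simp only [add_neg_cancel_left]

end ChapmanKolmogorov

/-! ## §3 ★★ The semigroup law on densities: `T_α^{Q} ∘ T_β^{Q′} = T_γ^{QQ′}` for every integrable `F` -/

section Semigroup

variable {α β c : ℝ} (Q : Matrix κ ι ℝ) (Q' : Matrix ι ι' ℝ)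

omit [DecidableEq κ] [DecidableEq ι] in
/-- The joint integrand `(φ′, φ) ↦ e^{−½α‖ψ−Qφ′‖²}·e^{−½β‖φ′−Q′φ‖²}·F(φ)` is jointly (a.e.-strongly) measurable for measurable... integrable `F`. [folklore] -/
theorem aestronglyMeasurable_comp_integrand {F : (ι' → ℝ) → ℝ} (hF : Integrable F) (ψ : κ → ℝ) :
    AEStronglyMeasurable (fun q : (ι → ℝ) × (ι' → ℝ) =>
        Real.exp (-(1 / 2 : ℝ) * (α * ((ψ - Q *ᵥ q.1) ⬝ᵥ (ψ - Q *ᵥ q.1))))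
          * (Real.exp (-(1 / 2 : ℝ) * (β * ((q.1 - Q' *ᵥ q.2) ⬝ᵥ (q.1 - Q' *ᵥ q.2)))) * F q.2))
      ((volume : Measure (ι → ℝ)).prod (volume : Measure (ι' → ℝ))) := by
  have hc : Continuous fun q : (ι → ℝ) × (ι' → ℝ) =>
      Real.exp (-(1 / 2 : ℝ) * (α * ((ψ - Q *ᵥ q.1) ⬝ᵥ (ψ - Q *ᵥ q.1))))
        * Real.exp (-(1 / 2 : ℝ) * (β * ((q.1 - Q' *ᵥ q.2) ⬝ᵥ (q.1 - Q' *ᵥ q.2)))) := by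
    simp only [dotProduct, Matrix.mulVec, Pi.sub_apply]
    fun_prop
  have h2 : AEStronglyMeasurable (fun q : (ι → ℝ) × (ι' → ℝ) => F q.2)
      ((volume : Measure (ι → ℝ)).prod (volume : Measure (ι' → ℝ))) := hF.aestronglyMeasurable.comp_snd
  have h := hc.aestronglyMeasurable.mul h2
  refine h.congr (Filter.Eventually.of_forall fun q => ?_)
  simp only [Pi.mul_apply]
  ring

/-- **The joint integrand is integrable** (`integrable_prod_iff'`: Gaussian fibres in `φ′`; fibre masses `≤ 𝒩·|F(φ)|`). [folklore] -/
theorem integrable_comp_integrand (hα : 0 < α) (hβ : 0 < β) (hc : 0 ≤ c) (hQ : Q * Qᵀ = c • (1 : Matrix κ κ ℝ))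
    {F : (ι' → ℝ) → ℝ} (hF : Integrable F) (ψ : κ → ℝ) :
    Integrable (fun q : (ι → ℝ) × (ι' → ℝ) =>
        Real.exp (-(1 / 2 : ℝ) * (α * ((ψ - Q *ᵥ q.1) ⬝ᵥ (ψ - Q *ᵥ q.1))))
          * (Real.exp (-(1 / 2 : ℝ) * (β * ((q.1 - Q' *ᵥ q.2) ⬝ᵥ (q.1 - Q' *ᵥ q.2)))) * F q.2))
      ((volume : Measure (ι → ℝ)).prod (volume : Measure (ι' → ℝ))) := by
  rw [integrable_prod_iff' (aestronglyMeasurable_comp_integrand Q Q' hF ψ)]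
  refine ⟨Filter.Eventually.of_forall fun φ => ?_, ?_⟩
  · have h := (integrable_kernel_kernel Q hα hβ ψ (Q' *ᵥ φ)).mul_const (F φ)
    refine h.congr (Filter.Eventually.of_forall fun φ' => ?_)
    beta_reduce
    ring
  · -- the fibre masses: `∫‖·‖dφ′ = 𝒩(bsPrec)·e^{−½γ‖ψ−QQ′φ‖²}·|F φ|`
    have hN : 0 < gaussNorm (bsPrec α Q (β • (1 : Matrix ι ι ℝ))) :=
      gaussNorm_pos hβ (coercive_bsPrec Q _ hα.le (coercive_scalar β))
    have hγ : 0 < α * β / (β + α * c) := comp_const_pos hα hβ hc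
    have hcont : Continuous fun φ : ι' → ℝ =>
        gaussNorm (bsPrec α Q (β • (1 : Matrix ι ι ℝ)))
          * Real.exp (-(1 / 2 : ℝ) * ((α * β / (β + α * c)) * ((ψ - Q *ᵥ (Q' *ᵥ φ)) ⬝ᵥ (ψ - Q *ᵥ (Q' *ᵥ φ))))) := by
      simp only [dotProduct, Matrix.mulVec, Pi.sub_apply]
      fun_prop
    have hbdd : ∀ᵐ φ : ι' → ℝ ∂volume, ‖gaussNorm (bsPrec α Q (β • (1 : Matrix ι ι ℝ)))
          * Real.exp (-(1 / 2 : ℝ) * ((α * β / (β + α * c)) * ((ψ - Q *ᵥ (Q' *ᵥ φ)) ⬝ᵥ (ψ - Q *ᵥ (Q' *ᵥ φ)))))‖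
        ≤ gaussNorm (bsPrec α Q (β • (1 : Matrix ι ι ℝ))) := by
      refine Filter.Eventually.of_forall fun φ => ?_
      rw [Real.norm_eq_abs, abs_of_pos (mul_pos hN (Real.exp_pos _))]
      have hq : 0 ≤ (ψ - Q *ᵥ (Q' *ᵥ φ)) ⬝ᵥ (ψ - Q *ᵥ (Q' *ᵥ φ)) := dotProduct_self_nonneg_real _
      have he : Real.exp (-(1 / 2 : ℝ) * ((α * β / (β + α * c)) * ((ψ - Q *ᵥ (Q' *ᵥ φ)) ⬝ᵥ (ψ - Q *ᵥ (Q' *ᵥ φ))))) ≤ 1 := by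
        rw [Real.exp_le_one_iff]
        nlinarith [hγ.le]
      nlinarith [hN.le]
    have h := hF.norm.bdd_mul hcont.aestronglyMeasurable hbdd
    refine h.congr (Filter.Eventually.of_forall fun φ => ?_)
    beta_reduce
    have hpt : ∀ φ' : ι → ℝ, ‖Real.exp (-(1 / 2 : ℝ) * (α * ((ψ - Q *ᵥ φ') ⬝ᵥ (ψ - Q *ᵥ φ'))))
          * (Real.exp (-(1 / 2 : ℝ) * (β * ((φ' - Q' *ᵥ φ) ⬝ᵥ (φ' - Q' *ᵥ φ)))) * F φ)‖
        = Real.exp (-(1 / 2 : ℝ) * (α * ((ψ - Q *ᵥ φ') ⬝ᵥ (ψ - Q *ᵥ φ'))))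
          * Real.exp (-(1 / 2 : ℝ) * (β * ((φ' - Q' *ᵥ φ) ⬝ᵥ (φ' - Q' *ᵥ φ)))) * ‖F φ‖ := by
      intro φ'
      rw [← mul_assoc, norm_mul, Real.norm_eq_abs, abs_of_pos (mul_pos (Real.exp_pos _) (Real.exp_pos _))]
    simp_rw [hpt]
    rw [integral_mul_const, integral_kernel_kernel Q hα hβ hc hQ ψ (Q' *ᵥ φ)]

/-- ★★ **THE SEMIGROUP LAW OF THE BLOCK-SPIN TRANSFORMATION ON DENSITIES**: for `QQᵀ = c·1`, `α, β > 0`, every block map `Q′`, every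
INTEGRABLE `F` and every coarse field `ψ`,
`√(α∕2π)^{|κ|} ∫dφ′ e^{−½α‖ψ−Qφ′‖²}·(√(β∕2π)^{|ι|} ∫dφ e^{−½β‖φ′−Q′φ‖²}F(φ)) = √(γ∕2π)^{|κ|} ∫dφ e^{−½γ‖ψ−Q(Q′φ)‖²}F(φ)`, `γ⁻¹ = α⁻¹ + cβ⁻¹` —
King's `T_{a,L}^k = T_{a_k,L^k}` (2.15) in kernel form, for the interacting densities as well as the free ones (Fubini + §2).
[cite: King1986, (2.4)–(2.6) p.652, (2.13)–(2.15) p.653] -/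
theorem blockSpinOp_comp (hα : 0 < α) (hβ : 0 < β) (hc : 0 ≤ c) (hQ : Q * Qᵀ = c • (1 : Matrix κ κ ℝ))
    {F : (ι' → ℝ) → ℝ} (hF : Integrable F) (ψ : κ → ℝ) :
    Real.sqrt (α / (2 * π)) ^ Fintype.card κ
        * ∫ φ' : ι → ℝ, Real.exp (-(1 / 2 : ℝ) * (α * ((ψ - Q *ᵥ φ') ⬝ᵥ (ψ - Q *ᵥ φ'))))
            * (Real.sqrt (β / (2 * π)) ^ Fintype.card ι
                * ∫ φ : ι' → ℝ, Real.exp (-(1 / 2 : ℝ) * (β * ((φ' - Q' *ᵥ φ) ⬝ᵥ (φ' - Q' *ᵥ φ)))) * F φ)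
      = Real.sqrt ((α * β / (β + α * c)) / (2 * π)) ^ Fintype.card κ
          * ∫ φ : ι' → ℝ, Real.exp (-(1 / 2 : ℝ) * ((α * β / (β + α * c)) * ((ψ - Q *ᵥ (Q' *ᵥ φ)) ⬝ᵥ (ψ - Q *ᵥ (Q' *ᵥ φ))))) * F φ := by
  set H : (ι → ℝ) × (ι' → ℝ) → ℝ := fun q =>
      Real.exp (-(1 / 2 : ℝ) * (α * ((ψ - Q *ᵥ q.1) ⬝ᵥ (ψ - Q *ᵥ q.1))))
        * (Real.exp (-(1 / 2 : ℝ) * (β * ((q.1 - Q' *ᵥ q.2) ⬝ᵥ (q.1 - Q' *ᵥ q.2)))) * F q.2) with hH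
  have hHi : Integrable H ((volume : Measure (ι → ℝ)).prod (volume : Measure (ι' → ℝ))) :=
    integrable_comp_integrand Q Q' hα hβ hc hQ hF ψ
  -- pull the inner constant out and the outer kernel in
  have hL : (∫ φ' : ι → ℝ, Real.exp (-(1 / 2 : ℝ) * (α * ((ψ - Q *ᵥ φ') ⬝ᵥ (ψ - Q *ᵥ φ'))))
        * (Real.sqrt (β / (2 * π)) ^ Fintype.card ι
            * ∫ φ : ι' → ℝ, Real.exp (-(1 / 2 : ℝ) * (β * ((φ' - Q' *ᵥ φ) ⬝ᵥ (φ' - Q' *ᵥ φ)))) * F φ))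
      = Real.sqrt (β / (2 * π)) ^ Fintype.card ι * ∫ φ' : ι → ℝ, ∫ φ : ι' → ℝ, H (φ', φ) := by
    rw [← integral_const_mul (Real.sqrt (β / (2 * π)) ^ Fintype.card ι) (fun φ' : ι → ℝ => ∫ φ : ι' → ℝ, H (φ', φ))]
    refine integral_congr_ae (Filter.Eventually.of_forall fun φ' => ?_)
    simp only [hH]
    rw [integral_const_mul]
    ring
  -- Fubini
  have hswap : ∫ φ' : ι → ℝ, ∫ φ : ι' → ℝ, H (φ', φ) = ∫ φ : ι' → ℝ, ∫ φ' : ι → ℝ, H (φ', φ) := by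
    rw [← integral_prod H hHi, integral_prod_symm H hHi]
  -- the inner `φ′`-integral is Chapman–Kolmogorov
  have hinner : ∀ φ : ι' → ℝ, ∫ φ' : ι → ℝ, H (φ', φ)
      = gaussNorm (bsPrec α Q (β • (1 : Matrix ι ι ℝ)))
          * (Real.exp (-(1 / 2 : ℝ) * ((α * β / (β + α * c)) * ((ψ - Q *ᵥ (Q' *ᵥ φ)) ⬝ᵥ (ψ - Q *ᵥ (Q' *ᵥ φ))))) * F φ) := by
    intro φ
    rw [hH]
    beta_reduce
    have hpt : ∀ φ' : ι → ℝ, Real.exp (-(1 / 2 : ℝ) * (α * ((ψ - Q *ᵥ φ') ⬝ᵥ (ψ - Q *ᵥ φ'))))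
          * (Real.exp (-(1 / 2 : ℝ) * (β * ((φ' - Q' *ᵥ φ) ⬝ᵥ (φ' - Q' *ᵥ φ)))) * F φ)
        = Real.exp (-(1 / 2 : ℝ) * (α * ((ψ - Q *ᵥ φ') ⬝ᵥ (ψ - Q *ᵥ φ'))))
          * Real.exp (-(1 / 2 : ℝ) * (β * ((φ' - Q' *ᵥ φ) ⬝ᵥ (φ' - Q' *ᵥ φ)))) * F φ := fun φ' => by ring
    simp_rw [hpt]
    rw [integral_mul_const, integral_kernel_kernel Q hα hβ hc hQ ψ (Q' *ᵥ φ), mul_assoc]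
  rw [hL, hswap]
  simp_rw [hinner]
  rw [integral_const_mul, ← mul_assoc, ← mul_assoc, gaussNorm_bsPrec_scalar Q hα hβ hc hQ]

end Semigroup

end Summit.QuantumFields.YangMills.BalabanUVNodes.N15KingModelRung.FreeField

end
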